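import Literature.MathematicalPhysics.QuantumFieldTheory.ConformalBootstrap3D.PointKernelK34L505Data
import Literature.MathematicalPhysics.QuantumFieldTheory.ConformalBootstrap3D.PointKernelK34L505Segs
import Literature.MathematicalPhysics.QuantumFieldTheory.ConformalBootstrap3D.PointKernelParts

/-!
# K34L505 certificate, kernel part file P9: one-cell head segments 56, 57 in level ranges

The head cells whose kernel evaluation exceeds one `decide` are one-cell segments of `hsegsK34L505`; each is
checked by `PCert.hPartSideOK` (side conditions) and `PCert.hPartOK` per level range `[n_lo, n_lo + count)`
against an integer claim, the claims summing to `≥ 0` (`PointKernel.partsOK`); soundness is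
`PCert.hParts_sound` (`PointKernelParts`).  The part files are mutually independent (each imports only
the data file); the ranges of one cell may span several of them, and the per-cell conclusions
`hparts_i` / `hcell_i` of those cells are assembled in `PointKernelK34L505.lean`.
Estimated kernel time 248 s.
-/

set_option maxRecDepth 100000
set_option maxHeartbeats 0

namespace Literature.MathematicalPhysics.QuantumFieldTheory.ConformalBootstrap3D.PointKernelK34L505

open Literature.MathematicalPhysics.QuantumFieldTheory.ConformalBootstrap3D.PointKernel

/-- levels `[31, 43)` of segment 56: partial lower sum `≥` claim. [folklore] -/
theorem part_56_1 : certK34L505.hPartOK (PCert.segAt hsegsK34L505 56) JHK34L505 31 12 (1507083439102280221371432291242160845) = true := by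
  decide +kernel

/-- levels `[43, 52)` of segment 56: partial lower sum `≥` claim. [folklore] -/
theorem part_56_2 : certK34L505.hPartOK (PCert.segAt hsegsK34L505 56) JHK34L505 43 9 (359160705519695492541715718422447946) = true := by
  decide +kernel

/-- levels `[52, 59)` of segment 56: partial lower sum `≥` claim. [folklore] -/
theorem part_56_3 : certK34L505.hPartOK (PCert.segAt hsegsK34L505 56) JHK34L505 52 7 (109393928866559503405299295838617701) = true := by
  decide +kernel

/-- one-cell segment 57 (row 4, cell `[20483/4096, 5121/1024]`, chord, `n_F = 58`,
4 level ranges): side conditions. [folklore] -/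
theorem pside_57 : certK34L505.hPartSideOK (PCert.segAt hsegsK34L505 57) JHK34L505 = true := by
  decide +kernel

/-- its level ranges `(n_lo, count, claim)`. [folklore] -/
def partsK34L505_57 : List (ℕ × ℕ × ℤ) := [(0, 31, -1941931313810062116263709464004659127), (31, 12, 1495999430492457266420777188032738299), (43, 9, 347870709020642871748175819102842142), (52, 7, 98061174296961978094756456869078687)]

/-- the ranges tile `[0, n_F]` and the claims sum to `≥ 0`. [folklore] -/
theorem pcov_57 : PointKernel.partsOK 58 partsK34L505_57 = true := by
  decide +kernel

/-- levels `[0, 31)` of segment 57: partial lower sum `≥` claim. [folklore] -/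
theorem part_57_0 : certK34L505.hPartOK (PCert.segAt hsegsK34L505 57) JHK34L505 0 31 (-1941931313810062116263709464004659127) = true := by
  decide +kernel

end Literature.MathematicalPhysics.QuantumFieldTheory.ConformalBootstrap3D.PointKernelK34L505
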